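import Mathlib
import Literature.NumberTheory.LFunctions.Zhang2022.Section15CVarpiPrimePow
import Literature.NumberTheory.LFunctions.Zhang2022.TypedAppendixA2
import Literature.NumberTheory.LFunctions.Zhang2022.Section3EulerFactors
import HarnessLib

/-!
# Zhang (2022), App. A p. 105 / §15 Lemma 15.3: the Euler factor `𝔲ᴿ₁ⱼ(q,s)` of
# `(ζ(s)²L(s−βⱼ,χ)²)⁻¹ Σₙ χ(n)τ₂(n)ϖ₁ⱼ(n)n^{−s}` in closed form — kernel-checked

Topic `Literature/NumberTheory/LFunctions/Zhang2022` (Landau–Siegel audit tree; verdict-neutral).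
Y. Zhang, *Discrete mean estimates and the Landau–Siegel zero*, arXiv:2211.02515v1 (2022)
[Zhang2022LandauSiegel] — **an unrefereed manuscript under adjudication; nothing in this file asserts
or denies its Theorems 1–2.** ZHANG-L discharge lane (WP15), third file of the chain towards the leaf
`Typed.Section15C.Lemma153RpI` (rows G-L4t3-1 / G-d52-1). The Appendix-A sketch of Lemma 15.3
("We give a sketch only … it can be verified that the factor `𝔲₁ⱼ(q,s)` … satisfies …", p. 105,
tex L5172–L5185) is carried out here for the REPAIRED factor `Typed.AppendixA2.frakU1FactorR`
(normaliser `(1−q^{−s})²(1−χ(q)q^{βⱼ−s})²`, row G-L4t3-1): with `x = q^{−s}`, `w = χ(q)q^{βⱼ}x` and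
the three ratios `Q = 𝓜₁(1,q)/𝓜₁(1,1)`, `R = λ₁(q)𝓜₁(q,1)/𝓜₁(1,1)`, `P = λ₁(q)𝓜₁(q,q)/𝓜₁(1,1)` (all
at `1 − βⱼ`),

  `𝔲ᴿ₁ⱼ(q,s) = (1−x)²(1−w)² + Q(1−w)²(2x−x²) + R(1−x)²(2w−w²) + P·wx(3 − 2x − 2w + wx)`,

an exact polynomial identity (the series `Σ_r χ(qʳ)τ₂(qʳ)ϖ₁ⱼ(qʳ)xʳ` is summed through
`ϖ₁ⱼ(qʳ) = Σ_{a+b=r} λ₁(qᵃ)q^{aβⱼ}χ(qᵇ)𝓜₁(qᵃ,qᵇ)/𝓜₁(1,1)` and the four cases of the local factors of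
the companion file `Section15CVarpiPrimePow`).

What is PROVED here (theorems only; no new definitions, no facts): the geometric/Cauchy-product sums
used, `calM1_prime_pow_div_eq` (the ratio `𝓜₁(qᵃ,qᵇ)/𝓜₁(1,1)` is one of four local ratios),
`varpi1_prime_pow_eq_sum_range` (the divisor-pair sum at a prime power), `coeff_prime_pow_eq` (the
`r`-th coefficient), and **`frakU1FactorR_eq_poly`** (the identity above), under the pointwise
hypotheses "the Euler product of `𝓜₁(1,1;1−βⱼ)` converges to a non-zero value" (true for all large `D`
under (A), `Lemma153Rp.eq15_18_at_betaJ`) and `χ(q) = ±1` (i.e. `q ∤ D`).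

## References

* Y. Zhang, arXiv:2211.02515v1 (2022), §15 p. 85 (definition of `ϖ₁ⱼ`), Lemma 15.3 p. 87, App. A
  p. 105. [cite: Zhang2022LandauSiegel, App. A p. 105]
-/

noncomputable section

open Complex Real Filter Topology Finset

namespace Literature.NumberTheory.LFunctions.Zhang2022.Lemma153Rp

open Literature.NumberTheory.LFunctions.Zhang2022
open Literature.NumberTheory.LFunctions.Zhang2022.Typed.Section15A
open Literature.NumberTheory.LFunctions.Zhang2022.Typed.Section15B

/-! ## §1. Power-series sums: `Σ(n+1)zⁿ`, and the interior double sum via Cauchy products -/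

/-- `Σ_{n≥1} (n+1)zⁿ = 1/(1−z)² − 1` for `‖z‖ < 1`. [cite: Zhang2022LandauSiegel, App. A p. 105] -/
theorem hasSum_succ_mul_pow_pos {z : ℂ} (hz : ‖z‖ < 1) :
    HasSum (fun n : ℕ => if n = 0 then (0 : ℂ) else ((n : ℂ) + 1) * z ^ n) (1 / (1 - z) ^ 2 - 1) := by
  have h := (Section3EulerFactors.hasSum_natCast_add_one_mul_pow hz).sub (hasSum_ite_eq 0 (1 : ℂ))
  have hfun : (fun n : ℕ => if n = 0 then (0 : ℂ) else ((n : ℂ) + 1) * z ^ n) =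
      fun b : ℕ => ((b : ℂ) + 1) * z ^ b - if b = 0 then 1 else 0 := by
    funext n
    split_ifs with hn
    · subst hn; simp
    · simp
  rw [hfun]; exact h

/-- `Σ_{n≥1} zⁿ = z/(1−z)` for `‖z‖ < 1`. [cite: Zhang2022LandauSiegel, App. A p. 105] -/
theorem hasSum_pow_pos {z : ℂ} (hz : ‖z‖ < 1) :
    HasSum (fun n : ℕ => if n = 0 then (0 : ℂ) else z ^ n) (z / (1 - z)) := by
  have hz1 : (1 : ℂ) - z ≠ 0 := by
    intro h
    have : ‖z‖ = 1 := by rw [← sub_eq_zero.mp h]; simp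
    linarith
  have h := (hasSum_geometric_of_norm_lt_one hz).sub (hasSum_ite_eq 0 (1 : ℂ))
  have hfun : (fun n : ℕ => if n = 0 then (0 : ℂ) else z ^ n) =
      fun b : ℕ => z ^ b - if b = 0 then 1 else 0 := by
    funext n
    split_ifs with hn
    · subst hn; simp
    · simp
  have hval : z / (1 - z) = (1 - z)⁻¹ - 1 := by field_simp; ring
  rw [hfun, hval]; exact h

/-- **The interior double sum**: for `‖x‖, ‖w‖ < 1`,
`Σ_{r} (r+1)Σ_{0<k<r} wᵏx^{r−k} = (1/(1−w)² − 1)·x/(1−x) + (w/(1−w))·x/(1−x)²`, by splitting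
`r + 1 = (k+1) + (r−k)` into two Cauchy products (elementary step of the sketch).
[cite: Zhang2022LandauSiegel, App. A p. 105] -/
theorem hasSum_interior {x w : ℂ} (hx : ‖x‖ < 1) (hw : ‖w‖ < 1) :
    HasSum (fun r : ℕ => ∑ k ∈ range (r + 1),
        if k = 0 ∨ k = r then (0 : ℂ) else ((r : ℂ) + 1) * w ^ k * x ^ (r - k))
      ((1 / (1 - w) ^ 2 - 1) * (x / (1 - x)) + w / (1 - w) * (x / (1 - x) ^ 2)) := by
  -- the four one-variable sequences
  set f₁ : ℕ → ℂ := fun k => if k = 0 then 0 else ((k : ℂ) + 1) * w ^ k with hf₁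
  set g₁ : ℕ → ℂ := fun b => if b = 0 then 0 else x ^ b with hg₁
  set f₂ : ℕ → ℂ := fun k => if k = 0 then 0 else w ^ k with hf₂
  set g₂ : ℕ → ℂ := fun b => (b : ℂ) * x ^ b with hg₂
  have hF₁ : HasSum f₁ (1 / (1 - w) ^ 2 - 1) := hasSum_succ_mul_pow_pos hw
  have hG₁ : HasSum g₁ (x / (1 - x)) := hasSum_pow_pos hx
  have hF₂ : HasSum f₂ (w / (1 - w)) := hasSum_pow_pos hw
  have hG₂ : HasSum g₂ (x / (1 - x) ^ 2) := hasSum_coe_mul_geometric_of_norm_lt_one hx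
  -- norm-summability
  have hnw : Summable (fun k : ℕ => ((k : ℝ) + 1) * ‖w‖ ^ k) := by
    have h1 : Summable (fun k : ℕ => (k : ℝ) * ‖w‖ ^ k) :=
      (hasSum_coe_mul_geometric_of_norm_lt_one (by rwa [norm_norm])).summable
    have h2 : Summable (fun k : ℕ => ‖w‖ ^ k) := summable_geometric_of_lt_one (norm_nonneg _) hw
    exact (h1.add h2).congr fun k => by ring
  have hnx : Summable (fun k : ℕ => (k : ℝ) * ‖x‖ ^ k) :=
    (hasSum_coe_mul_geometric_of_norm_lt_one (by rwa [norm_norm])).summable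
  have hsf₁ : Summable (fun k => ‖f₁ k‖) := by
    refine Summable.of_nonneg_of_le (fun _ => norm_nonneg _) (fun k => ?_) hnw
    simp only [hf₁]
    split_ifs
    · rw [norm_zero]; positivity
    · rw [norm_mul, norm_pow]
      gcongr
      calc ‖(k : ℂ) + 1‖ ≤ ‖(k : ℂ)‖ + ‖(1 : ℂ)‖ := norm_add_le _ _
        _ = (k : ℝ) + 1 := by simp
  have hsg₁ : Summable (fun k => ‖g₁ k‖) := by
    refine Summable.of_nonneg_of_le (fun _ => norm_nonneg _) (fun k => ?_)
      (summable_geometric_of_lt_one (norm_nonneg _) hx)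
    simp only [hg₁]
    split_ifs
    · rw [norm_zero]; positivity
    · rw [norm_pow]
  have hsf₂ : Summable (fun k => ‖f₂ k‖) := by
    refine Summable.of_nonneg_of_le (fun _ => norm_nonneg _) (fun k => ?_)
      (summable_geometric_of_lt_one (norm_nonneg _) hw)
    simp only [hf₂]
    split_ifs
    · rw [norm_zero]; positivity
    · rw [norm_pow]
  have hsg₂ : Summable (fun k => ‖g₂ k‖) := by
    refine Summable.of_nonneg_of_le (fun _ => norm_nonneg _) (fun k => ?_) hnx
    simp only [hg₂]
    rw [norm_mul, norm_pow]
    simp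
  -- Cauchy products
  have hC₁ := tsum_mul_tsum_eq_tsum_sum_range_of_summable_norm hsf₁ hsg₁
  have hC₂ := tsum_mul_tsum_eq_tsum_sum_range_of_summable_norm hsf₂ hsg₂
  have hS₁ : Summable (fun n => ∑ k ∈ range (n + 1), f₁ k * g₁ (n - k)) :=
    (summable_norm_sum_mul_range_of_summable_norm hsf₁ hsg₁).of_norm
  have hS₂ : Summable (fun n => ∑ k ∈ range (n + 1), f₂ k * g₂ (n - k)) :=
    (summable_norm_sum_mul_range_of_summable_norm hsf₂ hsg₂).of_norm
  have hH₁ : HasSum (fun n => ∑ k ∈ range (n + 1), f₁ k * g₁ (n - k))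
      ((1 / (1 - w) ^ 2 - 1) * (x / (1 - x))) := by
    rw [← hF₁.tsum_eq, ← hG₁.tsum_eq, hC₁]; exact hS₁.hasSum
  have hH₂ : HasSum (fun n => ∑ k ∈ range (n + 1), f₂ k * g₂ (n - k))
      (w / (1 - w) * (x / (1 - x) ^ 2)) := by
    rw [← hF₂.tsum_eq, ← hG₂.tsum_eq, hC₂]; exact hS₂.hasSum
  convert hH₁.add hH₂ using 1
  funext r
  rw [← sum_add_distrib]
  refine sum_congr rfl fun k hk => ?_
  have hkr : k ≤ r := Nat.lt_succ_iff.mp (mem_range.mp hk)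
  simp only [hf₁, hg₁, hf₂, hg₂]
  by_cases hk0 : k = 0
  · simp [hk0]
  · by_cases hkr' : k = r
    · subst hkr'; simp [hk0]
    · have hrk : r - k ≠ 0 := by omega
      simp only [hk0, hkr', or_self, if_false, hrk]
      have : ((r : ℂ) + 1) = ((k : ℂ) + 1) + ((r - k : ℕ) : ℂ) := by
        rw [Nat.cast_sub hkr]; ring
      rw [this]; ring

/-! ## §2. `ϖ₁ⱼ` at prime powers -/

variable (c' : ℝ) {D : ℕ} (χ : DirichletCharacter ℂ D)

/-- `λ₁(1, s) = 1` (empty product). [cite: Zhang2022LandauSiegel, §15 (15.10) p. 82] -/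
theorem lam1_one (s : ℂ) : lam1 c' χ 1 s = 1 := by
  unfold lam1; rw [Nat.primeFactors_one, prod_empty]

/-- `(qᵉ)ˢ = (qˢ)ᵉ` for naturals `q, e`. [folklore] -/
private theorem natCast_pow_cpow (q e : ℕ) (s : ℂ) : ((q ^ e : ℕ) : ℂ) ^ s = ((q : ℂ) ^ s) ^ e := by
  induction e with
  | zero => simp
  | succ e ih => rw [pow_succ, Nat.cast_mul, Complex.natCast_mul_natCast_cpow, ih, pow_succ]

/-- `τ₂(qʳ) = r + 1` (cf. `Literature.NumberTheory.Sieve.SmoothArcs.divisors_card_prime_pow`, not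
imported). [folklore] -/
private theorem card_divisors_prime_pow' {q : ℕ} (hq : q.Prime) (r : ℕ) : (q ^ r).divisors.card = r + 1 := by
  rw [Nat.divisors_prime_pow hq, card_map, card_range]

/-- **`𝓜₁(qᵃ,qᵇ;s)/𝓜₁(1,1;s)` is one of the four local ratios** `F_q(q^{a∧1},q^{b∧1};s)/F_q(1,1;s)`
((15.18) at a point + the locality of the factor at `q`), whenever the Euler product of `𝓜₁(1,1;s)`
converges to a non-zero value (`Re s > 0`). [cite: Zhang2022LandauSiegel, §15 (15.18) p. 85] -/
theorem calM1_prime_pow_div_eq [NeZero D] {q : ℕ} (hq : q.Prime) {s : ℂ} (hs : 0 < s.re)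
    (hmul : Multipliable fun p : Nat.Primes => calM1Factor c' χ (p : ℕ) 1 1 s)
    (hne : calM1 c' χ 1 1 s ≠ 0) (a b : ℕ) :
    calM1 c' χ (q ^ a) (q ^ b) s / calM1 c' χ 1 1 s =
      calM1Factor c' χ q (q ^ min a 1) (q ^ min b 1) s / calM1Factor c' χ q 1 1 s := by
  have hF0 : calM1Factor c' χ q 1 1 s ≠ 0 :=
    calM1Factor_ne_zero_of_calM1_ne_zero c' χ hmul hne ⟨q, hq⟩
  have hqa : 1 ≤ q ^ a := Nat.one_le_pow _ _ hq.pos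
  have hqb : 1 ≤ q ^ b := Nat.one_le_pow _ _ hq.pos
  rw [calM1_eq_calM1_mul_prod c' χ hs hmul hne hqa hqb, mul_div_cancel_left₀ _ hne, ← pow_add]
  rcases Nat.eq_zero_or_pos (a + b) with hab | hab
  · have ha : a = 0 := by omega
    have hb : b = 0 := by omega
    subst ha; subst hb
    simp [div_self hF0]
  · rw [Nat.primeFactors_prime_pow hab.ne' hq, prod_singleton,
      ← calM1Factor_div_eq_localRatio c' χ hq _ _ hs]
    -- reduce `(qᵃ, qᵇ)` to `(q^{a∧1}, q^{b∧1})`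
    have hleft : ∀ l : ℕ, 1 ≤ l → calM1Factor c' χ q (q ^ a) l s = calM1Factor c' χ q (q ^ min a 1) l s := by
      intro l hl
      rcases Nat.eq_zero_or_pos a with ha | ha
      · subst ha; simp
      · rw [Nat.min_eq_right ha, pow_one, calM1Factor_prime_pow_left c' χ hq ha hl]
    have hright : ∀ d : ℕ, 1 ≤ d → calM1Factor c' χ q d (q ^ b) s = calM1Factor c' χ q d (q ^ min b 1) s := by
      intro d hd
      rcases Nat.eq_zero_or_pos b with hb | hb
      · subst hb; simp
      · rw [Nat.min_eq_right hb, pow_one, calM1Factor_prime_pow_right c' χ hq hd hb]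
    rw [hleft _ hqb, hright _ (Nat.one_le_pow _ _ hq.pos)]

/-- **`ϖ₁ⱼ(qʳ)` as a sum over `a + b = r`**: `ϖ₁ⱼ(qʳ) = Σ_{a≤r} λ₁(qᵃ)(qᵃ)^{βⱼ}χ(q^{r−a})
𝓜₁(qᵃ,q^{r−a};1−βⱼ)/𝓜₁(1,1;1−βⱼ)` (the divisor pairs of `qʳ`).
[cite: Zhang2022LandauSiegel, §15 p. 85] -/
theorem varpi1_prime_pow_eq_sum_range {q : ℕ} (hq : q.Prime) (j r : ℕ) :
    varpi1 c' χ j (q ^ r) = ∑ a ∈ range (r + 1),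
      lam1 c' χ (q ^ a) 1 * ((q ^ a : ℕ) : ℂ) ^ Skeleton.betaJ c' D j * χ ((q ^ (r - a) : ℕ) : ZMod D) *
        (calM1 c' χ (q ^ a) (q ^ (r - a)) (1 - Skeleton.betaJ c' D j) /
          calM1 c' χ 1 1 (1 - Skeleton.betaJ c' D j)) := by
  unfold varpi1
  rw [Nat.sum_divisorsAntidiagonal (f := fun d l => lam1 c' χ d 1 * (d : ℂ) ^ Skeleton.betaJ c' D j *
      χ (l : ZMod D) * (calM1 c' χ d l (1 - Skeleton.betaJ c' D j) /
        calM1 c' χ 1 1 (1 - Skeleton.betaJ c' D j))),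
    Nat.sum_divisors_prime_pow hq]
  refine sum_congr rfl fun a ha => ?_
  have har : a ≤ r := Nat.lt_succ_iff.mp (mem_range.mp ha)
  rw [Nat.pow_div har hq.pos]

/-- `χ(qᵇ) = χ(q)ᵇ`. [cite: Zhang2022LandauSiegel, §15 p. 85] -/
theorem chi_prime_pow (q b : ℕ) : χ ((q ^ b : ℕ) : ZMod D) = χ (q : ZMod D) ^ b := by
  rw [Nat.cast_pow, map_pow]

/-! ## §3. The `r`-th coefficient of the local series -/

/-- **The `r`-th coefficient of `Σ_r χ(qʳ)τ₂(qʳ)ϖ₁ⱼ(qʳ)q^{−rs}`** in terms of `x = q^{−s}`,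
`w = χ(q)q^{βⱼ}x` and the ratios `Q = F_q(1,q)/F_q(1,1)`, `R = λ₁(q)F_q(q,1)/F_q(1,1)`,
`P = λ₁(q)F_q(q,q)/F_q(1,1)` (factors at `1 − βⱼ`):
`= [r=0] + Q[r≥1](r+1)xʳ + R[r≥1](r+1)wʳ + P(r+1)Σ_{0<k<r}wᵏx^{r−k}` (`χ(q) = ±1`).
[cite: Zhang2022LandauSiegel, App. A p. 105] -/
theorem coeff_prime_pow_eq [NeZero D] {q : ℕ} (hq : q.Prime) (hv : χ (q : ZMod D) ^ 2 = 1) (j : ℕ)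
    (hmul : Multipliable fun p : Nat.Primes =>
      calM1Factor c' χ (p : ℕ) 1 1 (1 - Skeleton.betaJ c' D j))
    (hne : calM1 c' χ 1 1 (1 - Skeleton.betaJ c' D j) ≠ 0) (s : ℂ) (r : ℕ) :
    χ ((q ^ r : ℕ) : ZMod D) * (((q ^ r).divisors.card : ℕ) : ℂ) * varpi1 c' χ j (q ^ r) /
        (q : ℂ) ^ ((r : ℂ) * s) =
      (if r = 0 then 1 else 0) +
      calM1Factor c' χ q 1 q (1 - Skeleton.betaJ c' D j) / calM1Factor c' χ q 1 1 (1 - Skeleton.betaJ c' D j) *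
        (if r = 0 then 0 else ((r : ℂ) + 1) * ((q : ℂ) ^ (-s)) ^ r) +
      lam1 c' χ q 1 * calM1Factor c' χ q q 1 (1 - Skeleton.betaJ c' D j) /
          calM1Factor c' χ q 1 1 (1 - Skeleton.betaJ c' D j) *
        (if r = 0 then 0 else ((r : ℂ) + 1) *
          (χ (q : ZMod D) * (q : ℂ) ^ Skeleton.betaJ c' D j * (q : ℂ) ^ (-s)) ^ r) +
      lam1 c' χ q 1 * calM1Factor c' χ q q q (1 - Skeleton.betaJ c' D j) /
          calM1Factor c' χ q 1 1 (1 - Skeleton.betaJ c' D j) *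
        ∑ k ∈ range (r + 1), (if k = 0 ∨ k = r then (0 : ℂ) else ((r : ℂ) + 1) *
          (χ (q : ZMod D) * (q : ℂ) ^ Skeleton.betaJ c' D j * (q : ℂ) ^ (-s)) ^ k *
            ((q : ℂ) ^ (-s)) ^ (r - k)) := by
  -- notation
  set s₀ : ℂ := 1 - Skeleton.betaJ c' D j with hs₀
  set x : ℂ := (q : ℂ) ^ (-s) with hx
  set t : ℂ := (q : ℂ) ^ Skeleton.betaJ c' D j with ht
  set v : ℂ := χ (q : ZMod D) with hvdef
  set F00 : ℂ := calM1Factor c' χ q 1 1 s₀ with hF00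
  set F01 : ℂ := calM1Factor c' χ q 1 q s₀ with hF01
  set F10 : ℂ := calM1Factor c' χ q q 1 s₀ with hF10
  set F11 : ℂ := calM1Factor c' χ q q q s₀ with hF11
  set lq : ℂ := lam1 c' χ q 1 with hlq
  have hs₀re : 0 < s₀.re := by rw [hs₀, one_sub_betaJ_re]; norm_num
  have hF0 : F00 ≠ 0 := calM1Factor_ne_zero_of_calM1_ne_zero c' χ hmul hne ⟨q, hq⟩
  -- `v^r · v^{r−a} = v^a` from `v² = 1`
  have hvv : ∀ {a r : ℕ}, a ≤ r → v ^ r * v ^ (r - a) = v ^ a := by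
    intro a r har
    rw [← pow_add, show r + (r - a) = a + 2 * (r - a) by omega, pow_add, pow_mul, hv, one_pow,
      mul_one]
  -- the left side as `v^r (r+1) x^r ϖ(q^r)`, `ϖ(q^r) = Σ_a g a`
  have hden : (q : ℂ) ^ ((r : ℂ) * s) = (x ^ r)⁻¹ := by
    rw [hx, Complex.cpow_nat_mul, Complex.cpow_neg, inv_pow, inv_inv]
  set g : ℕ → ℂ := fun a => lam1 c' χ (q ^ min a 1) 1 * t ^ a * v ^ (r - a) *
    (calM1Factor c' χ q (q ^ min a 1) (q ^ min (r - a) 1) s₀ / F00) with hg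
  have hterm : ∀ a ∈ range (r + 1),
      lam1 c' χ (q ^ a) 1 * ((q ^ a : ℕ) : ℂ) ^ Skeleton.betaJ c' D j * χ ((q ^ (r - a) : ℕ) : ZMod D) *
          (calM1 c' χ (q ^ a) (q ^ (r - a)) s₀ / calM1 c' χ 1 1 s₀) = g a := by
    intro a _
    rw [hg, calM1_prime_pow_div_eq c' χ hq hs₀re hmul hne a (r - a), chi_prime_pow, natCast_pow_cpow]
    have h1 : lam1 c' χ (q ^ a) 1 = lam1 c' χ (q ^ min a 1) 1 := by
      rcases Nat.eq_zero_or_pos a with h0 | h0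
      · subst h0; simp
      · rw [Nat.min_eq_right h0, pow_one, lam1_prime_pow c' χ hq h0]
    rw [h1]
  rw [hden, div_inv_eq_mul, chi_prime_pow, card_divisors_prime_pow' hq r, Nat.cast_succ,
    varpi1_prime_pow_eq_sum_range c' χ hq j r, sum_congr rfl hterm]
  -- case `r = 0`
  rcases Nat.eq_zero_or_pos r with hr0 | hr
  · subst hr0
    simp [hg, lam1_one]
    exact div_self hF0
  -- case `r = m + 1`
  obtain ⟨m, rfl⟩ : ∃ m, r = m + 1 := ⟨r - 1, by omega⟩
  have hne0 : m + 1 ≠ 0 := by omega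
  simp only [hne0, if_false, zero_add]
  -- the three kinds of terms of `Σ_a g a`
  have hg0 : g 0 = v ^ (m + 1) * (F01 / F00) := by
    simp only [hg, Nat.zero_min, pow_zero, Nat.sub_zero, lam1_one, one_mul]
    rw [show min (m + 1) 1 = 1 by omega, pow_one]
  have hgm : g (m + 1) = lq * t ^ (m + 1) * (F10 / F00) := by
    simp only [hg, Nat.sub_self, Nat.zero_min, pow_zero, mul_one]
    rw [show min (m + 1) 1 = 1 by omega, pow_one]
  have hgmid : ∀ a ∈ range m, g (a + 1) = lq * t ^ (a + 1) * v ^ (m - a) * (F11 / F00) := by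
    intro a ha
    have ham : a < m := mem_range.mp ha
    simp only [hg]
    rw [show min (a + 1) 1 = 1 by omega, show m + 1 - (a + 1) = m - a by omega,
      show min (m - a) 1 = 1 by omega, pow_one]
  have hSL : ∑ a ∈ range (m + 1 + 1), g a = (∑ a ∈ range m, g (a + 1)) + g 0 + g (m + 1) := by
    rw [sum_range_succ, sum_range_succ']
  -- the interior sum on the right
  set h : ℕ → ℂ := fun k => if k = 0 ∨ k = m + 1 then (0 : ℂ) else
    ((((m + 1 : ℕ) : ℂ)) + 1) * (v * t * x) ^ k * x ^ (m + 1 - k) with hh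
  have hSR : ∑ k ∈ range (m + 1 + 1), h k = ∑ k ∈ range m, h (k + 1) := by
    rw [sum_range_succ, sum_range_succ']
    have h0 : h 0 = 0 := by simp [hh]
    have hm1 : h (m + 1) = 0 := by simp [hh]
    rw [h0, hm1, add_zero, add_zero]
  have hhmid : ∀ k ∈ range m, h (k + 1) =
      ((((m + 1 : ℕ) : ℂ)) + 1) * (v * t * x) ^ (k + 1) * x ^ (m - k) := by
    intro k hk
    have hkm : k < m := mem_range.mp hk
    have h1 : ¬ (k + 1 = 0 ∨ k + 1 = m + 1) := by omega
    simp only [hh, h1, if_false]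
    rw [show m + 1 - (k + 1) = m - k by omega]
  change v ^ (m + 1) * ((((m + 1 : ℕ) : ℂ)) + 1) * (∑ a ∈ range (m + 1 + 1), g a) * x ^ (m + 1) =
    F01 / F00 * (((((m + 1 : ℕ) : ℂ)) + 1) * x ^ (m + 1)) +
    lq * F10 / F00 * (((((m + 1 : ℕ) : ℂ)) + 1) * (v * t * x) ^ (m + 1)) +
    lq * F11 / F00 * ∑ k ∈ range (m + 1 + 1), h k
  rw [hSL, hSR, hg0, hgm, sum_congr rfl hgmid, sum_congr rfl hhmid]
  -- termwise identity for the interior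
  have hmid : v ^ (m + 1) * ((((m + 1 : ℕ) : ℂ)) + 1) *
      (∑ a ∈ range m, lq * t ^ (a + 1) * v ^ (m - a) * (F11 / F00)) * x ^ (m + 1) =
      lq * F11 / F00 * ∑ k ∈ range m, ((((m + 1 : ℕ) : ℂ)) + 1) * (v * t * x) ^ (k + 1) * x ^ (m - k) := by
    rw [mul_sum, mul_sum, sum_mul]
    refine sum_congr rfl fun a ha => ?_
    have ham : a < m := mem_range.mp ha
    have hva : v ^ (m + 1) * v ^ (m - a) = v ^ (a + 1) := by
      have := @hvv (a + 1) (m + 1) (by omega)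
      rwa [show m + 1 - (a + 1) = m - a by omega] at this
    have hxa : x ^ (m + 1) = x ^ (a + 1) * x ^ (m - a) := by
      rw [← pow_add]; congr 1; omega
    rw [hxa]
    calc v ^ (m + 1) * ((((m + 1 : ℕ) : ℂ)) + 1) * (lq * t ^ (a + 1) * v ^ (m - a) * (F11 / F00)) *
          (x ^ (a + 1) * x ^ (m - a))
        = ((((m + 1 : ℕ) : ℂ)) + 1) * (lq * t ^ (a + 1) * (v ^ (m + 1) * v ^ (m - a)) * (F11 / F00)) *
          (x ^ (a + 1) * x ^ (m - a)) := by ring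
      _ = lq * F11 / F00 * (((((m + 1 : ℕ) : ℂ)) + 1) * (v * t * x) ^ (a + 1) * x ^ (m - a)) := by
          rw [hva]; ring
  -- the two end terms
  have hend0 : v ^ (m + 1) * v ^ (m + 1) = 1 := by
    rw [← pow_add, show m + 1 + (m + 1) = 2 * (m + 1) by omega, pow_mul, hv, one_pow]
  calc v ^ (m + 1) * ((((m + 1 : ℕ) : ℂ)) + 1) *
        ((∑ a ∈ range m, lq * t ^ (a + 1) * v ^ (m - a) * (F11 / F00)) + v ^ (m + 1) * (F01 / F00) +
          lq * t ^ (m + 1) * (F10 / F00)) * x ^ (m + 1)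
      = v ^ (m + 1) * ((((m + 1 : ℕ) : ℂ)) + 1) *
          (∑ a ∈ range m, lq * t ^ (a + 1) * v ^ (m - a) * (F11 / F00)) * x ^ (m + 1) +
        (v ^ (m + 1) * v ^ (m + 1)) * (F01 / F00 * (((((m + 1 : ℕ) : ℂ)) + 1) * x ^ (m + 1))) +
        lq * F10 / F00 * (((((m + 1 : ℕ) : ℂ)) + 1) * (v * t * x) ^ (m + 1)) := by ring
    _ = _ := by rw [hmid, hend0, one_mul]; ring

/-! ## §4. The repaired Euler factor in closed form -/

/-- `q^{−(s−βⱼ)} = q^{βⱼ}·q^{−s}`. [cite: Zhang2022LandauSiegel, §15 Lemma 15.3 p. 87] -/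
theorem cpow_neg_sub_betaJ {q : ℕ} (hq : q.Prime) (j : ℕ) (s : ℂ) :
    (q : ℂ) ^ (-(s - Skeleton.betaJ c' D j)) = (q : ℂ) ^ Skeleton.betaJ c' D j * (q : ℂ) ^ (-s) := by
  have hqC : (q : ℂ) ≠ 0 := by exact_mod_cast hq.ne_zero
  rw [show -(s - Skeleton.betaJ c' D j) = Skeleton.betaJ c' D j + (-s) by ring, Complex.cpow_add _ _ hqC]

/-- `‖q^{βⱼ}‖ = 1`. [cite: Zhang2022LandauSiegel, §2 (2.13)] -/
theorem norm_cpow_betaJ {q : ℕ} (hq : q.Prime) (j : ℕ) : ‖(q : ℂ) ^ Skeleton.betaJ c' D j‖ = 1 :=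
  norm_natCast_cpow_betaJ c' D j hq.one_lt.le

/-- `‖q^{−s}‖ < 1` for `Re s > 0`. [folklore] -/
private theorem norm_cpow_neg_lt_one {q : ℕ} (hq : q.Prime) {s : ℂ} (hs : 0 < s.re) :
    ‖(q : ℂ) ^ (-s)‖ < 1 := by
  rw [Complex.norm_natCast_cpow_of_pos hq.pos, Complex.neg_re]
  exact Real.rpow_lt_one_of_one_lt_of_neg (by exact_mod_cast hq.one_lt) (by linarith)

/-- **The repaired Euler factor `𝔲ᴿ₁ⱼ(q,s)` in closed form** (`Re s > 0`, `χ(q) = ±1`, and the Euler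
product of `𝓜₁(1,1;1−βⱼ)` convergent to a non-zero value): with `x = q^{−s}`, `w = χ(q)q^{βⱼ}x`,
`Q = F_q(1,q)/F_q(1,1)`, `R = λ₁(q)F_q(q,1)/F_q(1,1)`, `P = λ₁(q)F_q(q,q)/F_q(1,1)` (at `1 − βⱼ`),
`𝔲ᴿ₁ⱼ(q,s) = (1−x)²(1−w)² + Q(1−w)²(2x−x²) + R(1−x)²(2w−w²) + P·wx(3−2x−2w+wx)`.
[cite: Zhang2022LandauSiegel, App. A p. 105] -/
theorem frakU1FactorR_eq_poly [NeZero D] {q : ℕ} (hq : q.Prime) (hv : χ (q : ZMod D) ^ 2 = 1) (j : ℕ)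
    (hmul : Multipliable fun p : Nat.Primes =>
      calM1Factor c' χ (p : ℕ) 1 1 (1 - Skeleton.betaJ c' D j))
    (hne : calM1 c' χ 1 1 (1 - Skeleton.betaJ c' D j) ≠ 0) {s : ℂ} (hs : 0 < s.re) :
    Typed.AppendixA2.frakU1FactorR c' χ j q s =
      (1 - (q : ℂ) ^ (-s)) ^ 2 *
          (1 - χ (q : ZMod D) * (q : ℂ) ^ Skeleton.betaJ c' D j * (q : ℂ) ^ (-s)) ^ 2 +
        calM1Factor c' χ q 1 q (1 - Skeleton.betaJ c' D j) /
            calM1Factor c' χ q 1 1 (1 - Skeleton.betaJ c' D j) *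
          ((1 - χ (q : ZMod D) * (q : ℂ) ^ Skeleton.betaJ c' D j * (q : ℂ) ^ (-s)) ^ 2 *
            (2 * (q : ℂ) ^ (-s) - ((q : ℂ) ^ (-s)) ^ 2)) +
        lam1 c' χ q 1 * calM1Factor c' χ q q 1 (1 - Skeleton.betaJ c' D j) /
            calM1Factor c' χ q 1 1 (1 - Skeleton.betaJ c' D j) *
          ((1 - (q : ℂ) ^ (-s)) ^ 2 *
            (2 * (χ (q : ZMod D) * (q : ℂ) ^ Skeleton.betaJ c' D j * (q : ℂ) ^ (-s)) -
              (χ (q : ZMod D) * (q : ℂ) ^ Skeleton.betaJ c' D j * (q : ℂ) ^ (-s)) ^ 2)) +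
        lam1 c' χ q 1 * calM1Factor c' χ q q q (1 - Skeleton.betaJ c' D j) /
            calM1Factor c' χ q 1 1 (1 - Skeleton.betaJ c' D j) *
          ((χ (q : ZMod D) * (q : ℂ) ^ Skeleton.betaJ c' D j * (q : ℂ) ^ (-s)) * (q : ℂ) ^ (-s) *
            (3 - 2 * (q : ℂ) ^ (-s) - 2 * (χ (q : ZMod D) * (q : ℂ) ^ Skeleton.betaJ c' D j * (q : ℂ) ^ (-s)) +
              (χ (q : ZMod D) * (q : ℂ) ^ Skeleton.betaJ c' D j * (q : ℂ) ^ (-s)) * (q : ℂ) ^ (-s))) := by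
  set s₀ : ℂ := 1 - Skeleton.betaJ c' D j with hs₀
  set x : ℂ := (q : ℂ) ^ (-s) with hx
  set t : ℂ := (q : ℂ) ^ Skeleton.betaJ c' D j with ht
  set v : ℂ := χ (q : ZMod D) with hvdef
  set Q : ℂ := calM1Factor c' χ q 1 q s₀ / calM1Factor c' χ q 1 1 s₀ with hQ
  set R : ℂ := lam1 c' χ q 1 * calM1Factor c' χ q q 1 s₀ / calM1Factor c' χ q 1 1 s₀ with hR
  set P : ℂ := lam1 c' χ q 1 * calM1Factor c' χ q q q s₀ / calM1Factor c' χ q 1 1 s₀ with hP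
  set w : ℂ := v * t * x with hw
  have hxn : ‖x‖ < 1 := norm_cpow_neg_lt_one hq hs
  have hwn : ‖w‖ < 1 := by
    rw [hw, norm_mul, norm_mul, ht, norm_cpow_betaJ c' hq j, mul_one]
    calc ‖v‖ * ‖x‖ ≤ 1 * ‖x‖ := by gcongr; exact χ.norm_le_one _
      _ < 1 := by rw [one_mul]; exact hxn
  have hx1 : (1 : ℂ) - x ≠ 0 := by
    intro h; have : ‖x‖ = 1 := by rw [← sub_eq_zero.mp h]; simp
    linarith
  have hw1 : (1 : ℂ) - w ≠ 0 := by
    intro h; have : ‖w‖ = 1 := by rw [← sub_eq_zero.mp h]; simp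
    linarith
  -- the series
  have hA : HasSum (fun r : ℕ => if r = 0 then (1 : ℂ) else 0) 1 := hasSum_ite_eq 0 1
  have hB := (hasSum_succ_mul_pow_pos hxn).mul_left Q
  have hC := (hasSum_succ_mul_pow_pos hwn).mul_left R
  have hI := (hasSum_interior hxn hwn).mul_left P
  have hsum := hA.add ((hB.add hC).add hI)
  have hE : HasSum (fun r : ℕ => χ ((q ^ r : ℕ) : ZMod D) * (((q ^ r).divisors.card : ℕ) : ℂ) *
      varpi1 c' χ j (q ^ r) / (q : ℂ) ^ ((r : ℂ) * s))
      (1 + ((Q * (1 / (1 - x) ^ 2 - 1) + R * (1 / (1 - w) ^ 2 - 1)) +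
        P * ((1 / (1 - w) ^ 2 - 1) * (x / (1 - x)) + w / (1 - w) * (x / (1 - x) ^ 2)))) := by
    refine hsum.congr_fun fun r => ?_
    rw [coeff_prime_pow_eq c' χ hq hv j hmul hne s r]
    simp only [hQ, hR, hP, hw, hx, ht, hvdef, hs₀]
    ring
  unfold Typed.AppendixA2.frakU1FactorR
  rw [hE.tsum_eq, cpow_neg_sub_betaJ c' hq j s]
  simp only [← hx, ← ht, ← hvdef]
  rw [show v * (t * x) = w by rw [hw]; ring]
  field_simp
  ring

end Literature.NumberTheory.LFunctions.Zhang2022.Lemma153Rp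


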